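import Literature.MathematicalPhysics.QuantumFieldTheory.Balaban1983to89.B9GradLetterTransportedInputClasses
import Literature.MathematicalPhysics.QuantumFieldTheory.Balaban1983to89.B9DivViaGradLettersAtPins

/-!
# `Balaban1983to89.B9DivLetterTransportedInputClasses` — T. Bałaban, *Propagators for lattice gauge theories in a background field*, Commun. Math. Phys. **99** (1985) 389–434
# [Balaban1985BackgroundPropagators], (3.8) p. 392 + (3.40) p. 397 + (3.44)–(3.45) p. 398: THE LETTER `J†_ν(U)` OF `D*_U = Σ_ν J†_ν(U) ∘ ∇_{U,ν}` CARRIES THE PRINT-WEIGHTED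
# TRANSPORTED BOND CLASS `bHZKP (taxiB U) s` INTO THE PRINT-WEIGHTED TRANSPORTED SITE CLASS `bHZP (taxiS U) s` — the adjoint-direction twin of
# `B9GradLetterTransportedInputClasses.hasMaj_JcoKH_bHZP_bHZKP` (the ladder holonomy of `B9GradLetterLadderHolonomy` reversed; same hypothesis `hlad`)

[4] = T. Bałaban, *Propagators and renormalization transformations for lattice gauge theories. II*, Commun. Math. Phys. **96** (1984) 223–250 [`Balaban1984PropagatorsII`].
statement-level skeleton of published theorems with citation tags; proofs where landed; nothing here is a claim about the Yang–Mills mass gap.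

THE PRINT.  (3.8) p. 392 (the adjoint derivatives `D*_U`, `∇*_{U,μ}` along reversed bonds); (3.5) p. 391 (`U(x, x−e_μ) = U(x−e_μ, x)⁻¹`); p. 398 (remark after (3.47): *"we may
always replace ∇_U by ∇*_U, and vice versa, in arbitrary place and combination"*); (3.40) p. 397 (the transported Hölder quotient over admissible ∕ near pairs along *"a
shortest contour"*); (3.44)–(3.45) p. 398 (the Hölder SOURCE functional `‖λ‖^{ξ′}_ε + |λ|` of `R(U)∇*_UG₁(U)λ` ∕ `∇_UG(U)∇*_Uλ`); (3.35) p. 396; [4] (2.2) p. 224, (2.51)–(2.54)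
pp. 232–233, (2.137) p. 247.

WHY THIS FILE (cell `pub-ymgap`, node N06 [B9], seat `pub-ymgap-dag-n06-c` g22; dag-lead g31 WORDS 249 (3) «P-HRGDD leg (B)», dag-n06-l g32 I.32050: the ONE missing brick of
the `hrgdd13` supply).  dag-n06-w5's `B9DivViaGradLettersAtPins` writes the gauge-sector divergence at node00-def-Y's letters as `D*_U = Σ_ν J†_ν(U) ∘ ∇_{U,ν}` with the ONE-VALUE
transposed reading `(J†_νF)(z) = −R(U_ν(x − e_ν))⁻¹·F(⟨x − e_ν, ν⟩)`, `x = chart⁻¹z` (`JTb`, coordinates `JTcoKH`), and gives its SUP majorant (`hasMaj_JTcoKH`); the rows-20–21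
display of the N06 certificate reads the source `λ` of `R(U)∇*_UG₁λ` in a transported HÖLDER class, so the assembly (D) of `hrgdd13` needs `J†_ν` between the print-weighted
transported classes of dag-n06-l's `B9SmoothHolderClassP` — FROM the bond class `bHZKP (taxiB U) s` (base points = bond sources, transporter `U(Γ_{s,s′})`, admissible
pairs) INTO the site class `bHZP (taxiS U) s` (near site pairs).  This is the letter `J_μ` of `B9GradLetterTransportedInputClasses` (D1b-Main) read backwards: a site value
of `J†_νF` at `z = chart(p + e_ν)` is the inverse-link-rotated bond value at `⟨p, ν⟩`; the transported pair term at the near site pair `(chart(p+e_ν), chart(p′+e_ν))` is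
`−R(U_ν(p))⁻¹·[Y_p − R(U_ν(p)·U(Γ_{p+e_ν,p′+e_ν})·U_ν(p′)⁻¹)Y_{p′}]` (`trDif_JTcoKH`), i.e. the SOURCE's bond pair term at `(⟨p,ν⟩, ⟨p′,ν⟩)` plus a transporter discrepancy
`‖U(Γ_{p,p′}) − U_ν(p)U(Γ⁺)U_ν(p′)⁻¹‖ ≤ ‖U(Γ_{p,p′})U_ν(p′)U(Γ⁺)⁻¹U_ν(p)⁻¹ − 1‖` (`norm_sub_conj_le_ladder'`) — the SAME ladder as D1b's, so the same hypothesis `hlad`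
(discharged under print's (3.35) by `B9GradLetterLadderHolonomy.norm_jLadder_sub_one_le_of_reg335P` ∕ `B9GradLetterTransportedInputClassesPI.jLadder_hyp_of_reg335P`).
★★★ `hasMaj_JTcoKH_bHZKP_bHZP` — `HasMaj (bHZKP (taxiB U) s) (bHZP (taxiS U) s) (J†_ν U) (C_J†·e^{δr}·e^{−δd})`, `C_J† = L⁴·c_b·b_b·(2 + 2L⁴ + 2ΘL²)`, `r = 2(r_near + 1) +
2((d+1)(L+1) + 2)`, every `0 ≤ s ≤ 1`, `δ ≥ 0`: sup channel — one rotated bond value; pair channel — the source bond pair when the un-shifted pair is ADMISSIBLE (plus the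
ladder term `2Θ·L²·(Lʲ′η)^{−s}|λ|`), the REVERSED source pair when only the second bond source lies in `Δ̃(y′)`, and the sup channel with weight `≤ L⁴·(Lʲ′η)^{−s}` when the
near site pair is NOT admissible as a bond pair (its length exceeds `L^{j}` at a bond source; four one-level windows).  §1 is the dictionary (`assembleK_JTcoKH_shift`,
`abs_JTcoKH_apply_le_shift`, `jTb_pair_identity`, `trDif_JTcoKH`, `norm_sub_conj_le_ladder'`, `wEtaK_le_of_lt_pow`), §2 the theorem.

HONEST SCOPE.  Class bookkeeping over landed objects; the ladder bound is a HYPOTHESIS here (discharged by D1a under (3.35)); no estimate of [B9]'s propagators asserted;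
COUNT-NEUTRAL; N06 NOT discharged; nothing continuum, nothing about the mass gap.  A NEW file; 0 `def`, no `sorry`, no `axiom`, no `instance`, no `notation`.
-/

noncomputable section

namespace Literature.MathematicalPhysics.QuantumFieldTheory.Balaban1983to89.B9DivLetterTransportedInputClasses

open B4TorusKernel.MultiPeriod (torusSupNorm torusSupNorm_nonneg)
open B6GlobalChartV1 (PV blkV1 boxEquiv)
open B6Geom246MultiLevelTorus (geomT torusSupNorm_neg)
open B6Ineq2142KLevelV1 (β lvl)
open B6KLevelCensusIndexV1 (KIdx Adm adm_symm)
open B6MultiLevelTorusOperator (one_le_of_mem)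
open B6Prop22KLevelTorusCensusEta (nKT nKT_pos)
open B9GeoNormsKLevelV1 (geo9K)
open B9GeoLemma21KLevelV1 (geo9K_dist_triangle geo9K_len_pos geo9K_dist_comm)
open B9Thm34Ext (toB6)
open B11SectG (BlockNorm HasMaj)
open B11SectGGlobal (Size)
open B11SectGGlobalSizes
open B11SectGSmoothCutT (Size.ofPairsT ofPairsT_sz_le ofPairsT_term_le)
open B9Eq39Adjoint (R R_def)
open B9Thm39ReadingCoords (coordBound39 basisBound39 abs_repr_le)
open B9CoReadingCoords (assembleK XBK)
open B9CoReadingCoordsS (XSK sIK)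
open B9CoReadingCoordsH (assembleK_coordOpKH)
open B9MultiscaleSmoothPartitionY (scl scl_pos NearY levY_window_of_nearY)
open B9MultiscaleSmoothPartitionYNear (rNear dist_sIK_le_of_nearY)
open B9SmoothHolderClassS (NearPair wEta wEta_nonneg Wscl Wscl_nonneg one_le_Wscl)
open B9SmoothHolderClassK (srcY NearPairK wEtaK wEtaK_nonneg)
open B9SmoothHolderClassT (trDif trDif_apply)
open B9SmoothHolderClassTClosure (len_rpow_neg_eq_Wscl)
open B9SmoothHolderClassP (bHZP bHZP_loc bHZKP bHZKP_loc bHZKP_isLoc_iff)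
open B9GradViaDivLettersSmoothTerms (blkV1_level_eq_levY)
open B9GradViaDivLettersTransported (taxiS taxiB)
open B9DivViaGradLettersAtPins (JTb JTb_apply JTcoKH JTcoKH_apply)
open B9CoReadingCoordsHolderSNear (NearS)
open B9Eq340ProbeBridgeSNtoKA (supDist_eq_torusSupNorm)
open B9Eq340TaxiTelescope (norm_R_le)
open B9SmoothHolderClassSliceSNDict (levY_window_of_nearS wEta_chartY_eq_wEtaK nearPairK_of_adm len_le_of_lvl_le rpow_le_of_le_mul)
open B9GradLetterTransportedDict (norm_le_basisBound39_of_repr_le norm_R_sub_R_le jb_pair_identity supDist_shift_shift nearS_chartY_shift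
  levY_chartY_shift_window taxiS_chartY_shift weight_ratio_le inv_rpow_le_of_le_mul)
open Node00 (SiteY FBondY IBondY CfgY toKT levY parTaxiV)
open Node00.OpsYNablaBridge (chartY shift_unshift unshift_shift)
open Node00.OpsYSectDCoords (repr_assembleK)
open B9Thm33G0ProbeZeroAtPinsAdm (norm_assembleK_le unitaryLike_parTaxiV)
open T4RelativeLadder (UnitaryLike norm_mul_unit_le)
open LatticeFieldCalculus (supDist)

variable {d ℓ : ℕ} {hd : 1 ≤ d + 1} {hL : Odd (ℓ + 1) ∧ 1 < ℓ + 1} {b₀ b₁ : ℝ}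
variable {𝔸 : Type} [NormedRing 𝔸] [NormedAlgebra ℂ 𝔸] [CompleteSpace 𝔸]
variable {κ : Type} [Fintype κ]
variable (i : KIdx d ℓ hd hL b₀ b₁)

/-! ## §1 Dictionary of the letter `J†_ν`: its assembled site values, its transported pair term, the ladder, the weights -/

section Dict

omit [NormedAlgebra ℂ 𝔸] [CompleteSpace 𝔸] [Fintype κ] in
/-- ★ **THE TRANSPORTER DISCREPANCY OF `J†_ν` IS THE SAME LADDER DEFECT** as `J_μ`'s: `g − u·g⁺·u′⁻¹ = (g·u′·g⁺⁻¹·u⁻¹ − 1)·(u·g⁺·u′⁻¹)`, so for unitary-like `u, g⁺, u′`: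
`‖g − u g⁺ u′⁻¹‖ ≤ ‖g·u′·g⁺⁻¹·u⁻¹ − 1‖` (`g = U(Γ_{p,p′})`, `g⁺ = U(Γ_{p+e_ν,p′+e_ν})`, `u, u′` the two ν-links) — the SAME right-hand side as
`B9GradLetterTransportedDict.norm_sub_conj_le_ladder` (which bounds `‖g⁺ − u⁻¹gu′‖`; substituting the inverse links there would produce the conjugate-inverse ladder instead, so the
four-line factorisation is done directly). [cite: Balaban1985BackgroundPropagators, (3.40) p.397 + (3.8) p.392, bookkeeping] -/
theorem norm_sub_conj_le_ladder' [NormOneClass 𝔸] {u u' g gp : 𝔸ˣ} (hu : UnitaryLike u) (hgp : UnitaryLike gp) (hu' : UnitaryLike u') :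
    ‖(g : 𝔸) - ((u * gp * u'⁻¹ : 𝔸ˣ) : 𝔸)‖ ≤ ‖((g * u' * gp⁻¹ * u⁻¹ : 𝔸ˣ) : 𝔸) - 1‖ := by
  have e : (g * u' * gp⁻¹ * u⁻¹) * (u * gp * u'⁻¹) = g := by group
  have key : (g : 𝔸) - ((u * gp * u'⁻¹ : 𝔸ˣ) : 𝔸) = (((g * u' * gp⁻¹ * u⁻¹ : 𝔸ˣ) : 𝔸) - 1) * ((u * gp * u'⁻¹ : 𝔸ˣ) : 𝔸) := by
    rw [sub_mul, one_mul, ← Units.val_mul, e]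
  rw [key]
  exact norm_mul_unit_le ((hu.mul hgp).mul hu'.inv) _

omit [NormedAlgebra ℂ 𝔸] [CompleteSpace 𝔸] [Fintype κ] in
/-- ★★ **THE ALGEBRA OF THE PAIR TERM OF `J†_ν`**: `−R(u⁻¹)Y − R(g)(−R(u′⁻¹)Y′) = −R(u⁻¹)·(Y − R(u·g·u′⁻¹)Y′)` (`jb_pair_identity` at the inverse links).
[cite: Balaban1985BackgroundPropagators, (3.40) p.397 + (3.8) p.392, bookkeeping] -/
theorem jTb_pair_identity (u u' g : 𝔸ˣ) (Y Y' : 𝔸) : -R u⁻¹ Y - R g (-R u'⁻¹ Y') = -R u⁻¹ (Y - R (u * g * u'⁻¹) Y') := by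
  have h := jb_pair_identity u⁻¹ u'⁻¹ g Y Y'
  rwa [inv_inv] at h

omit [Fintype κ] in
/-- the bond weight of a pair LONGER than `L^{j}` read against a block `y′` with `j(y′) ≤ j + k`: `wEtaK s q q′ ≤ Lᵏ·Wscl s y′` (`B9SmoothHolderClassSliceSNDict.wEtaK_le_of_lt`
with a general window `k`). [cite: Balaban1985BackgroundPropagators, (3.40) p.397; Balaban1984PropagatorsII, (2.137) p.247, bookkeeping] -/
theorem wEtaK_le_of_lt_pow {s : ℝ} (hs0 : 0 ≤ s) (hs1 : s ≤ 1) {q q' : XBK κ i} {j k : ℕ} {y' : IBondY i}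
    (hlt : (ℓ + 1) ^ j < supDist q.1.src q'.1.src) (hj : lvl i.hN i.D i.hk y' ≤ j + k) :
    wEtaK i s q q' ≤ (((ℓ + 1 : ℕ) : ℝ)) ^ k * Wscl i s y' := by
  have hL1 : (1 : ℝ) ≤ ((ℓ + 1 : ℕ) : ℝ) := by exact_mod_cast Nat.succ_le_succ (Nat.zero_le ℓ)
  have hL2 : (1 : ℝ) ≤ (((ℓ + 1 : ℕ) : ℝ)) ^ k := one_le_pow₀ hL1
  have hL20 : (0 : ℝ) < (((ℓ + 1 : ℕ) : ℝ)) ^ k := by positivity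
  have hN : (0 : ℝ) < (nKT (toKT i) : ℝ) := nKT_pos _
  have hscl : 0 < scl i y' := scl_pos i y'
  have h1 : scl i y' ≤ (((ℓ + 1 : ℕ) : ℝ)) ^ k * (supDist q.1.src q'.1.src : ℝ) := by
    rw [scl]
    have h3 : (((ℓ + 1 : ℕ) : ℝ)) ^ j ≤ (supDist q.1.src q'.1.src : ℝ) := by exact_mod_cast hlt.le
    calc (((ℓ + 1 : ℕ) : ℝ)) ^ lvl i.hN i.D i.hk y' ≤ (((ℓ + 1 : ℕ) : ℝ)) ^ (j + k) := pow_le_pow_right₀ hL1 hj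
      _ = (((ℓ + 1 : ℕ) : ℝ)) ^ k * (((ℓ + 1 : ℕ) : ℝ)) ^ j := by ring
      _ ≤ _ := mul_le_mul_of_nonneg_left h3 hL20.le
  set a : ℝ := scl i y' / (nKT (toKT i) : ℝ) with ha
  set c : ℝ := (supDist q.1.src q'.1.src : ℝ) / (nKT (toKT i) : ℝ) with hc
  have ha0 : 0 < a := by positivity
  have hac : a / (((ℓ + 1 : ℕ) : ℝ)) ^ k ≤ c := by
    rw [div_le_iff₀ hL20, ha, hc, div_mul_eq_mul_div, div_le_div_iff_of_pos_right hN]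
    linarith
  have haL : 0 < a / (((ℓ + 1 : ℕ) : ℝ)) ^ k := by positivity
  rw [wEtaK, Wscl, ← hc, ← ha]
  calc (c ^ s)⁻¹ ≤ ((a / (((ℓ + 1 : ℕ) : ℝ)) ^ k) ^ s)⁻¹ := inv_anti₀ (Real.rpow_pos_of_pos haL _) (Real.rpow_le_rpow haL.le hac hs0)
    _ = ((((ℓ + 1 : ℕ) : ℝ)) ^ k) ^ s * (a ^ s)⁻¹ := by
        rw [Real.div_rpow ha0.le hL20.le, inv_div, div_eq_mul_inv]
    _ ≤ (((ℓ + 1 : ℕ) : ℝ)) ^ k * (a ^ s)⁻¹ := by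
        refine mul_le_mul_of_nonneg_right ?_ (inv_nonneg.2 (Real.rpow_nonneg ha0.le _))
        calc ((((ℓ + 1 : ℕ) : ℝ)) ^ k) ^ s ≤ ((((ℓ + 1 : ℕ) : ℝ)) ^ k) ^ (1 : ℝ) := Real.rpow_le_rpow_of_exponent_le hL2 hs1
          _ = _ := Real.rpow_one _

variable (b : Module.Basis κ ℝ 𝔸) {B : B9.Backgrounds} (cfg : B.Cfg → CfgY 𝔸 i) (U₁ : B.Cfg)

/-- ★ **THE ASSEMBLED SITE VALUE OF `J†_νF` AT `chart(p + e_ν)`**: `−R(U_ν(p))⁻¹` applied to the slice of `F` assembled at the bond `⟨p, ν⟩` (one transported value).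
[cite: Balaban1985BackgroundPropagators, (3.8) p.392 + (3.5) p.391] -/
theorem assembleK_JTcoKH_shift (ν : Fin (d + 1)) (F : XBK κ i → ℝ) (sl : Fin (d + 1)) (c' : κ) (p : Site (PV d ℓ i.m i.K hd hL) 0) :
    assembleK b sl c' (JTcoKH i b B cfg ν U₁ F) (chartY i (p.shift ν)) = -R (cfg U₁ ν p)⁻¹ (assembleK b sl c' F ⟨p, ν⟩) := by
  rw [JTcoKH, assembleK_coordOpKH, LinearMap.restrictScalars_apply, JTb_apply, Equiv.symm_apply_apply, unshift_shift]

/-- ★ **THE SIZE OF A COORDINATE OF `J†_νF`** (unitary-like links): `|(J†_νF)(chart(p+e_ν), sl, a, c)| ≤ c_b·‖Y_p‖`, `Y_p` the slice of `F` assembled at `⟨p, ν⟩`.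
[cite: Balaban1985BackgroundPropagators, (3.8) p.392 + (3.35) p.396, bookkeeping] -/
theorem abs_JTcoKH_apply_le_shift [NormOneClass 𝔸] [FiniteDimensional ℝ 𝔸] (hU : ∀ μ' t, UnitaryLike (cfg U₁ μ' t)) (ν : Fin (d + 1)) (F : XBK κ i → ℝ)
    (p : Site (PV d ℓ i.m i.K hd hL) 0) (sl : Fin (d + 1)) (a c' : κ) :
    |JTcoKH i b B cfg ν U₁ F (chartY i (p.shift ν), sl, a, c')| ≤ coordBound39 b * ‖assembleK b sl c' F ⟨p, ν⟩‖ := by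
  have hcb : 0 ≤ coordBound39 b := by unfold coordBound39; exact norm_nonneg _
  rw [JTcoKH_apply]
  dsimp only
  rw [JTb_apply, Equiv.symm_apply_apply, unshift_shift, map_neg, Finsupp.neg_apply, abs_neg]
  exact (abs_repr_le b _ a).trans (mul_le_mul_of_nonneg_left (norm_R_le (hU ν p).inv _) hcb)

/-- ★★ **THE TRANSPORTED PAIR TERM OF `J†_νF` AT THE NEAR SITE PAIR `(chart(p+e_ν), chart(p′+e_ν))`**:
`Δ^{taxiS}(J†_νF) = −R(U_ν(p))⁻¹·(Y_p − R(U_ν(p)·U(Γ_{p+e_ν,p′+e_ν})·U_ν(p′)⁻¹)Y_{p′})` read in the coordinate `a` (`Y_p, Y_{p′}` the slices of `F` assembled at `⟨p,ν⟩`, `⟨p′,ν⟩`).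
[cite: Balaban1985BackgroundPropagators, (3.40) p.397 + (3.8) p.392] -/
theorem trDif_JTcoKH [FiniteDimensional ℝ 𝔸] (ν : Fin (d + 1)) (F : XBK κ i → ℝ) (p p' : Site (PV d ℓ i.m i.K hd hL) 0) (sl : Fin (d + 1)) (a c' : κ) :
    trDif b (taxiS i B cfg U₁) (chartY i (p.shift ν), sl, a, c') (chartY i (p'.shift ν), sl, a, c') (JTcoKH i b B cfg ν U₁ F) =
      b.repr (-R (cfg U₁ ν p)⁻¹ (assembleK b sl c' F ⟨p, ν⟩ -
        R (cfg U₁ ν p * parTaxiV (cfg U₁) (p.shift ν) (p'.shift ν) * (cfg U₁ ν p')⁻¹) (assembleK b sl c' F ⟨p', ν⟩))) a := by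
  rw [trDif_apply]
  dsimp only
  rw [assembleK_JTcoKH_shift, assembleK_JTcoKH_shift, taxiS_chartY_shift, jTb_pair_identity]

end Dict

/-! ## §2 ★★★ The letter `J†_ν` from the bond class into the site class -/

section Main

variable [Fintype (geo9K i).Site] (b : Module.Basis κ ℝ 𝔸) {B : B9.Backgrounds} (cfg : B.Cfg → CfgY 𝔸 i) (U₁ : B.Cfg)
variable {R₀ : ℝ} {H₀ : Prop} {bI : FBondY i → IBondY i}

set_option maxHeartbeats 4000000 in -- ONE B1-size case analysis (sup ∕ admissible pair ∕ reversed pair ∕ non-admissible ∕ ladder channels) in a single majorant proof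
/-- ★★★ **THE HÖLDER-SOURCE LETTER `J†_ν` FROM THE TRANSPORTED BOND CLASS INTO THE TRANSPORTED SITE CLASS.**  For unitary-like bond variables, a `1`-faithful bond block map
`bI`, print's units, `0 ≤ s ≤ 1`, any `δ ≥ 0`, and the LADDER hypothesis `hlad` of `B9GradLetterTransportedInputClasses.hasMaj_JcoKH_bHZP_bHZKP` (on admissible pairs
`‖U(Γ_{x,x′})U_ν(x′)U(Γ_{x+e_ν,x′+e_ν})⁻¹U_ν(x)⁻¹ − 1‖ ≤ Θ·|x−x′|_∞∕L^{j(x′)}`, `Θ ≥ 0` — print's (3.35), D1a):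
`HasMaj (bHZKP (taxiB U) s) (bHZP (taxiS U) s) (J†_ν U) (L⁴c_bb_b(2 + 2L⁴ + 2ΘL²)·e^{δr}·e^{−δd(y,y′)})`, `r = 2(r_near+1) + 2((d+1)(L+1)+2)` (module docstring).
[cite: Balaban1985BackgroundPropagators, (3.8) p.392 + (3.40) p.397 + (3.44)–(3.45) p.398 + p.398 (remark after (3.47)) + (3.35) p.396; Balaban1984PropagatorsII, (2.2) p.224, (2.51)–(2.54) pp.232–233, (2.137) p.247] -/
theorem hasMaj_JTcoKH_bHZKP_bHZP [NormOneClass 𝔸] [FiniteDimensional ℝ 𝔸] (hU : ∀ μ' t, UnitaryLike (cfg U₁ μ' t))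
    (hβ1 : ∀ f : FBondY i, (geomT i.D).dist (β i.hN i.D i.hk (bI f)) (blkV1 i.hN i.D f) ≤ 1) (hcf : |i.cf| = (nKT (toKT i) : ℝ))
    {s : ℝ} (hs0 : 0 ≤ s) (hs1 : s ≤ 1) {δ : ℝ} (hδ : 0 ≤ δ) (ν : Fin (d + 1)) {Θ : ℝ} (hΘ : 0 ≤ Θ)
    (hlad : ∀ x x' : Site (PV d ℓ i.m i.K hd hL) 0, Adm i ⟨x, ν⟩ ⟨x', ν⟩ →
      ‖((parTaxiV (cfg U₁) x x' * cfg U₁ ν x' * (parTaxiV (cfg U₁) (x.shift ν) (x'.shift ν))⁻¹ * (cfg U₁ ν x)⁻¹ : 𝔸ˣ) : 𝔸) - 1‖ ≤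
        Θ * ((supDist x x' : ℝ) / (((ℓ + 1 : ℕ) : ℝ)) ^ levY i (chartY i x'))) :
    HasMaj (bHZKP (κ := κ) i b (taxiB i B cfg U₁) (R := R₀) (H := H₀) hs0 hs1)
      (bHZP (κ := κ) i b (taxiS i B cfg U₁) (R := R₀) (H := H₀) hs0 hs1) (JTcoKH i b B cfg ν U₁)
      (fun y y' => ((((ℓ + 1 : ℕ) : ℝ)) ^ 4 * coordBound39 b * basisBound39 b * (2 + 2 * (((ℓ + 1 : ℕ) : ℝ)) ^ 4 + 2 * Θ * (((ℓ + 1 : ℕ) : ℝ)) ^ 2)) *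
        Real.exp (δ * (2 * (rNear d ℓ + 1) + 2 * (((d : ℝ) + 1) * (((ℓ : ℝ) + 1) + 1) + 2))) * Real.exp (-(δ * (geo9K i).dist y y'))) := by
  classical
  haveI : Nonempty (Fin (PV d ℓ i.m i.K hd hL).d) := ⟨⟨0, Nat.succ_pos d⟩⟩
  intro y' F hA y
  rw [bHZP_loc]
  rw [bHZKP_isLoc_iff] at hA
  set L : ℝ := ((ℓ + 1 : ℕ) : ℝ) with hLdef
  have hL1 : (1 : ℝ) ≤ L := by rw [hLdef]; exact_mod_cast Nat.succ_le_succ (Nat.zero_le ℓ)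
  have hL0 : 0 < L := lt_of_lt_of_le one_pos hL1
  set C₁ : ℝ := ((d : ℝ) + 1) * (((ℓ : ℝ) + 1) + 1) + 2 with hC₁
  have hC₁0 : 0 ≤ C₁ := by positivity
  set rσ : ℝ := 2 * (rNear d ℓ + 1) + 2 * C₁ with hrσ
  set E : ℝ := Real.exp (δ * rσ) * Real.exp (-(δ * (geo9K i).dist y y')) with hE
  have hE0 : 0 ≤ E := by positivity
  have hE1 : (geo9K i).dist y y' ≤ rσ → 1 ≤ E := by
    intro hd
    rw [hE, ← Real.exp_add, ← Real.exp_zero]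
    exact Real.exp_le_exp.2 (by nlinarith)
  have hcb : 0 ≤ coordBound39 b := by unfold coordBound39; exact norm_nonneg _
  have hbb : 0 ≤ basisBound39 b := Finset.sum_nonneg fun _ _ => norm_nonneg _
  have hN : (0 : ℝ) < (nKT (toKT i) : ℝ) := nKT_pos _
  have hR0 : ∀ g : 𝔸ˣ, R g (0 : 𝔸) = 0 := fun g => by rw [R_def, mul_zero, zero_mul]
  -- THE SOURCE (the bond class at `y′`): its two channels and their sizes
  set locS : ℝ := (bHZKP (κ := κ) i b (taxiB i B cfg U₁) (R := R₀) (H := H₀) hs0 hs1).loc y' F with hlocS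
  set SupS : ℝ := (Size.ofSup (toB6 (geo9K i) R₀ H₀) (fun (q : XBK κ i) (y : IBondY i) => NearY i y (srcY i q))).sz y' F with hSupS
  set PairS : ℝ := (Size.ofPairsT (toB6 (geo9K i) R₀ H₀) (fun (q : XBK κ i) (y : IBondY i) => NearY i y (srcY i q)) (NearPairK i) (wEtaK i s) (wEtaK_nonneg i s)
    (trDif b (taxiB i B cfg U₁))).sz y' F with hPairS
  have hSupS0 : 0 ≤ SupS := Size.nonneg _ _ _
  have hPairS0 : 0 ≤ PairS := Size.nonneg _ _ _
  have hlocS_eq : locS = Wscl i (1 - s) y' * (Wscl i s y' * SupS + PairS) := by rw [hlocS, bHZKP_loc]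
  have hy' : 0 < (geo9K i).len y' := geo9K_len_pos i y'
  have hy : 0 < (geo9K i).len y := geo9K_len_pos i y
  have hW1' : Wscl i (1 - s) y' = (geo9K i).len y' ^ (s - 1) := by rw [← len_rpow_neg_eq_Wscl i hcf, neg_sub]
  have hWs' : Wscl i s y' = (geo9K i).len y' ^ (-s) := by rw [← len_rpow_neg_eq_Wscl i hcf]
  have hW1 : Wscl i (1 - s) y = (geo9K i).len y ^ (s - 1) := by rw [← len_rpow_neg_eq_Wscl i hcf, neg_sub]
  have hWs : Wscl i s y = (geo9K i).len y ^ (-s) := by rw [← len_rpow_neg_eq_Wscl i hcf]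
  have hW1'inv : (Wscl i (1 - s) y')⁻¹ = (geo9K i).len y' ^ (1 - s) := by rw [hW1', ← Real.rpow_neg hy'.le, neg_sub]
  have hW1inv : (Wscl i (1 - s) y)⁻¹ = (geo9K i).len y ^ (1 - s) := by rw [hW1, ← Real.rpow_neg hy.le, neg_sub]
  have hW1'pos : 0 < Wscl i (1 - s) y' := lt_of_lt_of_le zero_lt_one (one_le_Wscl i (by linarith) y')
  have hWs'0 : 0 ≤ Wscl i s y' := Wscl_nonneg i _ _
  have hlocS0 : 0 ≤ locS := (bHZKP (κ := κ) i b (taxiB i B cfg U₁) (R := R₀) (H := H₀) hs0 hs1).loc_nonneg _ _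
  have hSupS_le : SupS ≤ (geo9K i).len y' * locS := by
    have h1 : Wscl i (1 - s) y' * (Wscl i s y' * SupS) ≤ locS := by
      rw [hlocS_eq, mul_add]; exact le_add_of_nonneg_right (mul_nonneg hW1'pos.le hPairS0)
    rw [hW1', hWs', ← mul_assoc, ← Real.rpow_add hy', show s - 1 + -s = (-1 : ℝ) by ring, Real.rpow_neg_one] at h1
    rwa [inv_mul_le_iff₀ hy'] at h1
  have hPairS_le : PairS ≤ (geo9K i).len y' ^ (1 - s) * locS := by
    have h1 : Wscl i (1 - s) y' * PairS ≤ locS := by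
      rw [hlocS_eq, mul_add]; exact le_add_of_nonneg_left (by positivity)
    have h2 : PairS ≤ (Wscl i (1 - s) y')⁻¹ * locS :=
      calc PairS = (Wscl i (1 - s) y')⁻¹ * (Wscl i (1 - s) y' * PairS) := by rw [← mul_assoc, inv_mul_cancel₀ hW1'pos.ne', one_mul]
        _ ≤ (Wscl i (1 - s) y')⁻¹ * locS := mul_le_mul_of_nonneg_left h1 (inv_nonneg.2 hW1'pos.le)
    rwa [hW1'inv] at h2
  have hlenSup : Wscl i s y' * SupS ≤ (geo9K i).len y' ^ (1 - s) * locS := by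
    have h1 : Wscl i (1 - s) y' * (Wscl i s y' * SupS) ≤ locS := by
      rw [hlocS_eq, mul_add]; exact le_add_of_nonneg_right (mul_nonneg hW1'pos.le hPairS0)
    have h2 : Wscl i s y' * SupS ≤ (Wscl i (1 - s) y')⁻¹ * locS :=
      calc Wscl i s y' * SupS = (Wscl i (1 - s) y')⁻¹ * (Wscl i (1 - s) y' * (Wscl i s y' * SupS)) := by
            rw [← mul_assoc, inv_mul_cancel₀ hW1'pos.ne', one_mul]
        _ ≤ (Wscl i (1 - s) y')⁻¹ * locS := mul_le_mul_of_nonneg_left h1 (inv_nonneg.2 hW1'pos.le)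
    rwa [hW1'inv] at h2
  -- the source values and the assembled bond slices
  have hAq : ∀ q : XBK κ i, |F q| ≤ SupS := by
    intro q
    by_cases h : NearY i y' (srcY i q)
    · exact ofSup_abs_le (g := toB6 (geo9K i) R₀ H₀) (fun (q : XBK κ i) (y : IBondY i) => NearY i y (srcY i q)) h F
    · rw [hA q h, abs_zero]; exact hSupS0
  have hX : ∀ (xb : FBondY i) (sl : Fin (d + 1)) (c : κ), ‖assembleK b sl c F xb‖ ≤ basisBound39 b * SupS :=
    fun xb sl c => norm_assembleK_le b sl c F xb fun a => hAq (xb, sl, a, c)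
  have hX0 : ∀ (xb : FBondY i) (sl : Fin (d + 1)) (c : κ), ¬ NearY i y' (chartY i xb.src) → assembleK b sl c F xb = 0 := by
    intro xb sl c hw
    unfold assembleK
    exact Finset.sum_eq_zero fun a _ => by rw [hA (xb, sl, a, c) hw, zero_smul]
  -- GEOMETRY: the target block `y ∋ chart(p + e_ν)`, the source block `y′ ∋ chart p` (or `chart p′`)
  have hshiftd : ∀ x : Site (PV d ℓ i.m i.K hd hL) 0, (geo9K i).dist (sIK i bI (chartY i x)) (sIK i bI (chartY i (x.shift ν))) ≤ C₁ :=
    fun x => B9Eq340NearPairBlocks.near_dist_carrier_le i hβ1 (B9Eq340ProbeTransferSNY.nearS_supDist i (nearS_chartY_shift i x ν))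
  have hnearSd : ∀ {z z' : SiteY i}, NearS i z z' → (geo9K i).dist (sIK i bI z) (sIK i bI z') ≤ C₁ :=
    fun h => B9Eq340NearPairBlocks.near_dist_carrier_le i hβ1 (B9Eq340ProbeTransferSNY.nearS_supDist i h)
  -- weight comparison of the two blocks: `Lʲ′η ≤ L⁴·E·Lʲη` once the levels are within 4 and the blocks within `rσ`
  have hcmp : lvl i.hN i.D i.hk y' ≤ lvl i.hN i.D i.hk y + 4 → (geo9K i).dist y y' ≤ rσ →
      (geo9K i).len y' ≤ L ^ 4 * E * (geo9K i).len y ∧ (geo9K i).len y' ^ (1 - s) ≤ L ^ 4 * E * (geo9K i).len y ^ (1 - s) := by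
    intro hl hd
    have h1 : (geo9K i).len y' ≤ L ^ 4 * (geo9K i).len y := by rw [hLdef]; exact len_le_of_lvl_le i hcf hl
    have h2 : (geo9K i).len y' ^ (1 - s) ≤ L ^ 4 * (geo9K i).len y ^ (1 - s) := by
      rw [hLdef] at h1 ⊢; exact rpow_le_of_le_mul hy'.le hy.le (by linarith) (by linarith) h1
    have hE1' := hE1 hd
    have hl4 : 0 ≤ L ^ 4 := by positivity
    constructor
    · calc (geo9K i).len y' ≤ L ^ 4 * (geo9K i).len y := h1
        _ = L ^ 4 * 1 * (geo9K i).len y := by ring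
        _ ≤ L ^ 4 * E * (geo9K i).len y := mul_le_mul_of_nonneg_right (mul_le_mul_of_nonneg_left hE1' hl4) hy.le
    · calc (geo9K i).len y' ^ (1 - s) ≤ L ^ 4 * (geo9K i).len y ^ (1 - s) := h2
        _ = L ^ 4 * 1 * (geo9K i).len y ^ (1 - s) := by ring
        _ ≤ L ^ 4 * E * (geo9K i).len y ^ (1 - s) := mul_le_mul_of_nonneg_right (mul_le_mul_of_nonneg_left hE1' hl4) (Real.rpow_nonneg hy.le _)
  -- THE SUP PART: a site value of `J†_νF` at `chart(p+e_ν)` is a rotated bond value at `⟨p, ν⟩`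
  set M : ℝ := coordBound39 b * basisBound39 b * (L ^ 4 * E * (geo9K i).len y * locS) with hM
  have hM0 : 0 ≤ M := by positivity
  have hpt : ∀ q : XSK κ i, NearY i y q.1 → |JTcoKH i b B cfg ν U₁ F q| ≤ M := by
    rintro ⟨z, sl, a, c⟩ hz
    obtain ⟨x, rfl⟩ := (chartY i).surjective z
    obtain ⟨p, rfl⟩ : ∃ p : Site (PV d ℓ i.m i.K hd hL) 0, p.shift ν = x := ⟨x.unshift ν, shift_unshift i x ν⟩
    have hz' : NearY i y (chartY i (p.shift ν)) := hz
    refine (abs_JTcoKH_apply_le_shift i b cfg U₁ hU ν F p sl a c).trans ?_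
    by_cases hw : NearY i y' (chartY i p)
    · have hl : lvl i.hN i.D i.hk y' ≤ lvl i.hN i.D i.hk y + 4 := by
        have h1 := (levY_window_of_nearY i hz').2
        have h2 := (levY_chartY_shift_window i p ν).1
        have h3 := (levY_window_of_nearY i hw).1
        omega
      have hd : (geo9K i).dist y y' ≤ rσ := by
        have d1 : (geo9K i).dist y (sIK i bI (chartY i (p.shift ν))) ≤ rNear d ℓ + 1 := dist_sIK_le_of_nearY i hβ1 hz'
        have d2 : (geo9K i).dist (sIK i bI (chartY i (p.shift ν))) (sIK i bI (chartY i p)) ≤ C₁ := by rw [geo9K_dist_comm]; exact hshiftd p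
        have d3 : (geo9K i).dist (sIK i bI (chartY i p)) y' ≤ rNear d ℓ + 1 := by rw [geo9K_dist_comm]; exact dist_sIK_le_of_nearY i hβ1 hw
        calc (geo9K i).dist y y' ≤ (geo9K i).dist y (sIK i bI (chartY i (p.shift ν))) + (geo9K i).dist (sIK i bI (chartY i (p.shift ν))) y' :=
              geo9K_dist_triangle i _ _ _
          _ ≤ (geo9K i).dist y (sIK i bI (chartY i (p.shift ν))) + ((geo9K i).dist (sIK i bI (chartY i (p.shift ν))) (sIK i bI (chartY i p)) +
                (geo9K i).dist (sIK i bI (chartY i p)) y') := add_le_add le_rfl (geo9K_dist_triangle i _ _ _)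
          _ ≤ rσ := by rw [hrσ]; linarith [d1, d2, d3, hC₁0]
      have h1 := (hcmp hl hd).1
      calc coordBound39 b * ‖assembleK b sl c F ⟨p, ν⟩‖ ≤ coordBound39 b * (basisBound39 b * SupS) := mul_le_mul_of_nonneg_left (hX _ _ _) hcb
        _ ≤ coordBound39 b * (basisBound39 b * ((geo9K i).len y' * locS)) := mul_le_mul_of_nonneg_left (mul_le_mul_of_nonneg_left hSupS_le hbb) hcb
        _ ≤ coordBound39 b * (basisBound39 b * (L ^ 4 * E * (geo9K i).len y * locS)) :=
            mul_le_mul_of_nonneg_left (mul_le_mul_of_nonneg_left (mul_le_mul_of_nonneg_right h1 hlocS0) hbb) hcb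
        _ = M := by rw [hM]; ring
    · rw [hX0 ⟨p, ν⟩ sl c hw, norm_zero, mul_zero]; exact hM0
  have hsupPart : Wscl i (1 - s) y * (Wscl i s y * (Size.ofSup (toB6 (geo9K i) R₀ H₀) (fun (q : XSK κ i) (y : IBondY i) => NearY i y q.1)).sz y
      (JTcoKH i b B cfg ν U₁ F)) ≤ coordBound39 b * basisBound39 b * L ^ 4 * E * locS := by
    have h1 : (Size.ofSup (toB6 (geo9K i) R₀ H₀) (fun (q : XSK κ i) (y : IBondY i) => NearY i y q.1)).sz y (JTcoKH i b B cfg ν U₁ F) ≤ M :=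
      ofSup_sz_le _ hM0 fun q (hq : NearY i y q.1) => hpt q hq
    have hWW : Wscl i (1 - s) y * Wscl i s y = ((geo9K i).len y)⁻¹ := by
      rw [hW1, hWs, ← Real.rpow_add hy, show s - 1 + -s = (-1 : ℝ) by ring, Real.rpow_neg_one]
    calc Wscl i (1 - s) y * (Wscl i s y * _) = (Wscl i (1 - s) y * Wscl i s y) * _ := by ring
      _ ≤ (Wscl i (1 - s) y * Wscl i s y) * M := mul_le_mul_of_nonneg_left h1 (mul_nonneg (Wscl_nonneg i _ _) (Wscl_nonneg i _ _))
      _ = (((geo9K i).len y)⁻¹ * (geo9K i).len y) * (coordBound39 b * basisBound39 b * L ^ 4 * E * locS) := by rw [hWW, hM]; ring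
      _ = coordBound39 b * basisBound39 b * L ^ 4 * E * locS := by rw [inv_mul_cancel₀ hy.ne', one_mul]
  -- THE PAIR PART
  set Ci : ℝ := 1 + 2 * L ^ 4 + 2 * Θ * L ^ 2 with hCi
  have hCi0 : 0 ≤ Ci := by positivity
  set Cp : ℝ := coordBound39 b * basisBound39 b * Ci * L ^ 4 with hCp
  have hCp0 : 0 ≤ Cp := by positivity
  set M₂ : ℝ := Cp * E * (geo9K i).len y ^ (1 - s) * locS with hM₂
  have hM₂0 : 0 ≤ M₂ := by have := Real.rpow_nonneg hy.le (1 - s); positivity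
  have hpair : ∀ q q' : XSK κ i, NearY i y q.1 → NearPair i q q' →
      wEta i s q q' * |trDif b (taxiS i B cfg U₁) q q' (JTcoKH i b B cfg ν U₁ F)| ≤ M₂ := by
    rintro ⟨z, sl, a, c⟩ ⟨z', sl'⟩ hz hP
    obtain ⟨hne, hns, hsl⟩ := hP
    dsimp only at hne hns hsl hz
    subst hsl
    obtain ⟨x, rfl⟩ := (chartY i).surjective z
    obtain ⟨x', rfl⟩ := (chartY i).surjective z'
    obtain ⟨p, rfl⟩ : ∃ p : Site (PV d ℓ i.m i.K hd hL) 0, p.shift ν = x := ⟨x.unshift ν, shift_unshift i x ν⟩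
    obtain ⟨p', rfl⟩ : ∃ p' : Site (PV d ℓ i.m i.K hd hL) 0, p'.shift ν = x' := ⟨x'.unshift ν, shift_unshift i x' ν⟩
    have hz' : NearY i y (chartY i (p.shift ν)) := hz
    have hpp : p ≠ p' := fun h => hne (by rw [h])
    -- the target pair: the shifted sites, a NEAR site pair of length `|p − p′|_∞`
    set wP : SiteY i := chartY i (p.shift ν) with hwP
    set wQ : SiteY i := chartY i (p'.shift ν) with hwQ
    have hnS : NearS i wP wQ := hns
    have hsdshift : supDist (p.shift ν) (p'.shift ν) = supDist p p' := supDist_shift_shift p p' ν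
    have hT : torusSupNorm (toKT i).NB (wP.1 - wQ.1) = (supDist p p' : ℝ) := by
      rw [hwP, hwQ, ← neg_sub, torusSupNorm_neg (fun μ => one_le_of_mem (chartY i (p.shift ν)).2 μ), ← supDist_eq_torusSupNorm i, hsdshift]
    have hsdpos : (0 : ℝ) < (supDist p p' : ℝ) := by
      have h0 : supDist p p' ≠ 0 := fun h => hpp ((B3TorusRadialSums.supDist_eq_zero_iff p p').1 h)
      exact_mod_cast Nat.pos_of_ne_zero h0
    -- the target weight IS the bond weight of the un-shifted pair
    have hwshift : ∀ a' : κ, wEta i s (wP, sl, a', c) (wQ, sl, a', c) = wEtaK (κ := κ) i s (⟨p, ν⟩, sl, a, c) (⟨p', ν⟩, sl, a, c) := by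
      intro a'
      rw [hwP, hwQ, wEta_chartY_eq_wEtaK i s (p.shift ν) (p'.shift ν) ν sl sl a' c a' c, wEtaK, wEtaK]
      dsimp only
      rw [hsdshift]
    have hwrev : ∀ a' : κ, wEtaK (κ := κ) i s (⟨p', ν⟩, sl, a', c) (⟨p, ν⟩, sl, a', c) = wEtaK (κ := κ) i s (⟨p, ν⟩, sl, a, c) (⟨p', ν⟩, sl, a, c) := by
      intro a'
      rw [wEtaK, wEtaK]
      dsimp only
      rw [B3TorusRadialSums.supDist_comm]
    have hwa : ∀ a' : κ, wEtaK (κ := κ) i s (⟨p, ν⟩, sl, a', c) (⟨p', ν⟩, sl, a', c) = wEtaK (κ := κ) i s (⟨p, ν⟩, sl, a, c) (⟨p', ν⟩, sl, a, c) := by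
      intro a'
      rw [wEtaK, wEtaK]
    rw [hwshift a]
    have hw0 : 0 ≤ wEtaK (κ := κ) i s (⟨p, ν⟩, sl, a, c) (⟨p', ν⟩, sl, a, c) := wEtaK_nonneg i s _ _
    -- the letters: the two bond slices, the links, the two transporters
    set Yp : 𝔸 := assembleK b sl c F ⟨p, ν⟩ with hYp
    set Yq : 𝔸 := assembleK b sl c F ⟨p', ν⟩ with hYq
    set u : 𝔸ˣ := cfg U₁ ν p with hu
    set u' : 𝔸ˣ := cfg U₁ ν p' with hu'
    set g : 𝔸ˣ := parTaxiV (cfg U₁) (p.shift ν) (p'.shift ν) with hg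
    set gm : 𝔸ˣ := parTaxiV (cfg U₁) p p' with hgm
    have huu : UnitaryLike u := hU ν p
    have huu' : UnitaryLike u' := hU ν p'
    have hgu : UnitaryLike g := unitaryLike_parTaxiV hU _ _
    have hgmu : UnitaryLike gm := unitaryLike_parTaxiV hU _ _
    have hhu : UnitaryLike (u * g * u'⁻¹) := (huu.mul hgu).mul huu'.inv
    have hYpn : ‖Yp‖ ≤ basisBound39 b * SupS := hX _ _ _
    have hYqn : ‖Yq‖ ≤ basisBound39 b * SupS := hX _ _ _
    -- the transported pair term in coordinates
    have htr : trDif b (taxiS i B cfg U₁) (wP, sl, a, c) (wQ, sl, a, c) (JTcoKH i b B cfg ν U₁ F) = b.repr (-R u⁻¹ (Yp - R (u * g * u'⁻¹) Yq)) a := by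
      rw [hwP, hwQ, trDif_JTcoKH]
    have hD : |trDif b (taxiS i B cfg U₁) (wP, sl, a, c) (wQ, sl, a, c) (JTcoKH i b B cfg ν U₁ F)| ≤ coordBound39 b * ‖Yp - R (u * g * u'⁻¹) Yq‖ := by
      rw [htr]
      calc _ ≤ coordBound39 b * ‖-R u⁻¹ (Yp - R (u * g * u'⁻¹) Yq)‖ := abs_repr_le b _ a
        _ ≤ _ := by rw [norm_neg]; exact mul_le_mul_of_nonneg_left (norm_R_le huu.inv _) hcb
    -- the common end of the non-trivial cases
    have fin : ∀ {t : ℝ}, (NearY i y' (chartY i p) ∨ NearY i y' (chartY i p')) →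
        t ≤ coordBound39 b * basisBound39 b * Ci * ((geo9K i).len y' ^ (1 - s) * locS) → t ≤ M₂ := by
      intro t hor ht
      have hl : lvl i.hN i.D i.hk y' ≤ lvl i.hN i.D i.hk y + 4 := by
        have h1 := (levY_window_of_nearY i hz').2
        have h2 := (levY_window_of_nearS i hnS).2
        have h3 := (levY_chartY_shift_window i p ν).1
        have h4 := (levY_chartY_shift_window i p' ν).1
        rw [← hwP] at h3
        rw [← hwQ] at h4
        rcases hor with h | h
        · have h5 := (levY_window_of_nearY i h).1; omega
        · have h5 := (levY_window_of_nearY i h).1; omega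
      have hd : (geo9K i).dist y y' ≤ rσ := by
        have d1 : (geo9K i).dist y (sIK i bI wP) ≤ rNear d ℓ + 1 := dist_sIK_le_of_nearY i hβ1 hz'
        have d2 : (geo9K i).dist (sIK i bI wP) (sIK i bI wQ) ≤ C₁ := hnearSd hnS
        have d3 : (geo9K i).dist (sIK i bI wP) (sIK i bI (chartY i p)) ≤ C₁ := by rw [geo9K_dist_comm]; exact hshiftd p
        have d4 : (geo9K i).dist (sIK i bI wQ) (sIK i bI (chartY i p')) ≤ C₁ := by rw [geo9K_dist_comm]; exact hshiftd p'
        have dn := B9GeoNormsKLevelV1.geo9K_dist_nonneg i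
        rcases hor with h | h
        · have d5 : (geo9K i).dist (sIK i bI (chartY i p)) y' ≤ rNear d ℓ + 1 := by rw [geo9K_dist_comm]; exact dist_sIK_le_of_nearY i hβ1 h
          calc (geo9K i).dist y y' ≤ (geo9K i).dist y (sIK i bI wP) + (geo9K i).dist (sIK i bI wP) y' := geo9K_dist_triangle i _ _ _
            _ ≤ (geo9K i).dist y (sIK i bI wP) + ((geo9K i).dist (sIK i bI wP) (sIK i bI (chartY i p)) + (geo9K i).dist (sIK i bI (chartY i p)) y') :=
                add_le_add le_rfl (geo9K_dist_triangle i _ _ _)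
            _ ≤ rσ := by rw [hrσ]; linarith [d1, d3, d5, hC₁0, dn (sIK i bI wP) (sIK i bI wQ)]
        · have d5 : (geo9K i).dist (sIK i bI (chartY i p')) y' ≤ rNear d ℓ + 1 := by rw [geo9K_dist_comm]; exact dist_sIK_le_of_nearY i hβ1 h
          calc (geo9K i).dist y y' ≤ (geo9K i).dist y (sIK i bI wP) + (geo9K i).dist (sIK i bI wP) y' := geo9K_dist_triangle i _ _ _
            _ ≤ (geo9K i).dist y (sIK i bI wP) + ((geo9K i).dist (sIK i bI wP) (sIK i bI wQ) + (geo9K i).dist (sIK i bI wQ) y') :=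
                add_le_add le_rfl (geo9K_dist_triangle i _ _ _)
            _ ≤ (geo9K i).dist y (sIK i bI wP) + ((geo9K i).dist (sIK i bI wP) (sIK i bI wQ) +
                  ((geo9K i).dist (sIK i bI wQ) (sIK i bI (chartY i p')) + (geo9K i).dist (sIK i bI (chartY i p')) y')) :=
                add_le_add le_rfl (add_le_add le_rfl (geo9K_dist_triangle i _ _ _))
            _ ≤ rσ := by rw [hrσ]; linarith [d1, d2, d4, d5, hC₁0, dn (sIK i bI wP) (sIK i bI (chartY i p))]
      have h2 := (hcmp hl hd).2
      refine ht.trans ?_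
      rw [hM₂, hCp]
      have h0 : 0 ≤ coordBound39 b * basisBound39 b * Ci := by positivity
      calc coordBound39 b * basisBound39 b * Ci * ((geo9K i).len y' ^ (1 - s) * locS)
          ≤ coordBound39 b * basisBound39 b * Ci * ((L ^ 4 * E * (geo9K i).len y ^ (1 - s)) * locS) :=
            mul_le_mul_of_nonneg_left (mul_le_mul_of_nonneg_right h2 hlocS0) h0
        _ = _ := by ring
    -- the weight of a NON-admissible pair: `w ≤ L⁴·(Lʲ′η)^{−s}` (the pair is longer than `L^{j}` at a bond source; four one-level windows)
    have hwna : (NearY i y' (chartY i p) ∨ NearY i y' (chartY i p')) → ¬ Adm i ⟨p, ν⟩ ⟨p', ν⟩ →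
        wEtaK (κ := κ) i s (⟨p, ν⟩, sl, a, c) (⟨p', ν⟩, sl, a, c) ≤ L ^ 4 * Wscl i s y' := by
      intro hor hadm
      have hlp : (blkV1 i.hN i.D (⟨p, ν⟩ : FBondY i)).1.1 = levY i (chartY i p) := blkV1_level_eq_levY i ((⟨p, ν⟩ : FBondY i), ν, a, c)
      have hlq : (blkV1 i.hN i.D (⟨p', ν⟩ : FBondY i)).1.1 = levY i (chartY i p') := blkV1_level_eq_levY i ((⟨p', ν⟩ : FBondY i), ν, a, c)
      have h2 := levY_window_of_nearS i hnS
      have h3 := levY_chartY_shift_window i p ν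
      have h4 := levY_chartY_shift_window i p' ν
      rw [← hwP] at h3
      rw [← hwQ] at h4
      have hna : ¬ (supDist p p' ≤ (ℓ + 1) ^ (blkV1 i.hN i.D (⟨p, ν⟩ : FBondY i)).1.1 ∧ supDist p p' ≤ (ℓ + 1) ^ (blkV1 i.hN i.D (⟨p', ν⟩ : FBondY i)).1.1) :=
        fun h => hadm ⟨rfl, h.1, h.2⟩
      rw [hlp, hlq] at hna
      rw [hLdef]
      rcases not_and_or.1 hna with hlt | hlt
      · have hlt' : (ℓ + 1) ^ levY i (chartY i p) < supDist p p' := not_le.1 hlt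
        refine wEtaK_le_of_lt_pow i hs0 hs1 (q := ((⟨p, ν⟩ : FBondY i), sl, a, c)) (q' := ((⟨p', ν⟩ : FBondY i), sl, a, c)) hlt' ?_
        rcases hor with h | h
        · have h5 := (levY_window_of_nearY i h).1; omega
        · have h5 := (levY_window_of_nearY i h).1; omega
      · have hlt' : (ℓ + 1) ^ levY i (chartY i p') < supDist p p' := not_le.1 hlt
        refine wEtaK_le_of_lt_pow i hs0 hs1 (q := ((⟨p, ν⟩ : FBondY i), sl, a, c)) (q' := ((⟨p', ν⟩ : FBondY i), sl, a, c)) hlt' ?_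
        rcases hor with h | h
        · have h5 := (levY_window_of_nearY i h).1; omega
        · have h5 := (levY_window_of_nearY i h).1; omega
    -- the ladder term in the class units, ADMISSIBLE pair: `w·(|p−p′|∕L^{j′})·SupS ≤ L²·(Lʲ′η)^{−s}·SupS`
    have hwlad : (NearY i y' (chartY i p) ∨ NearY i y' (chartY i p')) → Adm i ⟨p, ν⟩ ⟨p', ν⟩ →
        wEtaK (κ := κ) i s (⟨p, ν⟩, sl, a, c) (⟨p', ν⟩, sl, a, c) * ((supDist p p' : ℝ) / (((ℓ + 1 : ℕ) : ℝ)) ^ levY i (chartY i p')) ≤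
          L ^ 2 * Wscl i s y' := by
      intro hor hadm
      have hLj : (0 : ℝ) < (((ℓ + 1 : ℕ) : ℝ)) ^ levY i (chartY i p') := pow_pos (by rw [← hLdef]; exact hL0) _
      have hsd' : (supDist p p' : ℝ) ≤ (((ℓ + 1 : ℕ) : ℝ)) ^ levY i (chartY i p') := by
        have h1 : (blkV1 i.hN i.D (⟨p', ν⟩ : FBondY i)).1.1 = levY i (chartY i p') := blkV1_level_eq_levY i ((⟨p', ν⟩ : FBondY i), ν, a, c)
        rw [← h1]; exact_mod_cast hadm.2.2
      have h1 : wEtaK (κ := κ) i s (⟨p, ν⟩, sl, a, c) (⟨p', ν⟩, sl, a, c) * ((supDist p p' : ℝ) / (((ℓ + 1 : ℕ) : ℝ)) ^ levY i (chartY i p')) ≤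
          (((((ℓ + 1 : ℕ) : ℝ)) ^ levY i (chartY i p') / (nKT (toKT i) : ℝ)) ^ s)⁻¹ := by
        rw [wEtaK]; dsimp only
        exact weight_ratio_le hsdpos hN hLj hsd' hs1
      -- `p` and `p′` are near sites (admissible pair), so `scl y′ ≤ L²·L^{j(p′)}`
      have hnpp : NearS i (chartY i p) (chartY i p') := by
        show torusSupNorm (toKT i).NB ((chartY i p).1 - (chartY i p').1) ≤ (((ℓ + 1 : ℕ) : ℝ)) ^ levY i (chartY i p)
        have e1 : (blkV1 i.hN i.D (⟨p, ν⟩ : FBondY i)).1.1 = levY i (chartY i p) := blkV1_level_eq_levY i ((⟨p, ν⟩ : FBondY i), ν, a, c)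
        rw [← neg_sub, torusSupNorm_neg (fun μ => one_le_of_mem (chartY i p).2 μ), ← supDist_eq_torusSupNorm i p p', ← e1]
        exact_mod_cast hadm.2.1
      have hjl : lvl i.hN i.D i.hk y' ≤ levY i (chartY i p') + 2 := by
        have h2 := (levY_window_of_nearS i hnpp).1
        rcases hor with h | h
        · have h5 := (levY_window_of_nearY i h).1; omega
        · have h5 := (levY_window_of_nearY i h).1; omega
      have hL1' : (1 : ℝ) ≤ ((ℓ + 1 : ℕ) : ℝ) := by rw [← hLdef]; exact hL1
      have hsclL : scl i y' ≤ L ^ 2 * (((ℓ + 1 : ℕ) : ℝ)) ^ levY i (chartY i p') := by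
        rw [scl, hLdef, ← pow_add]
        exact pow_le_pow_right₀ hL1' (by omega)
      have hscl : scl i y' / (nKT (toKT i) : ℝ) ≤ L ^ 2 * ((((ℓ + 1 : ℕ) : ℝ)) ^ levY i (chartY i p') / (nKT (toKT i) : ℝ)) := by
        rw [← mul_div_assoc]; exact div_le_div_of_nonneg_right hsclL hN.le
      have h2 : (((((ℓ + 1 : ℕ) : ℝ)) ^ levY i (chartY i p') / (nKT (toKT i) : ℝ)) ^ s)⁻¹ ≤ L ^ 2 * Wscl i s y' := by
        rw [Wscl]
        exact inv_rpow_le_of_le_mul (div_pos (scl_pos i y') hN) (div_pos hLj hN) (one_le_pow₀ hL1) hscl hs0 hs1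
      exact h1.trans h2
    by_cases h1 : NearY i y' (chartY i p)
    · -- the first bond source lies in Δ̃(y′)
      by_cases hadm : Adm i ⟨p, ν⟩ ⟨p', ν⟩
      · -- ADMISSIBLE: the source bond pair plus the ladder term
        -- ‖Yp − R h Yq‖ ≤ ‖Yp − R(U(Γ_{p,p′})) Yq‖ + 2‖U(Γ_{p,p′}) − h‖‖Yq‖
        have hsplit : ‖Yp - R (u * g * u'⁻¹) Yq‖ ≤ ‖Yp - R gm Yq‖ + 2 * ‖(gm : 𝔸) - ((u * g * u'⁻¹ : 𝔸ˣ) : 𝔸)‖ * ‖Yq‖ := by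
          have e : Yp - R (u * g * u'⁻¹) Yq = (Yp - R gm Yq) + (R gm Yq - R (u * g * u'⁻¹) Yq) := by abel
          rw [e]
          exact (norm_add_le _ _).trans (add_le_add le_rfl (norm_R_sub_R_le hgmu hhu Yq))
        -- the ladder
        have hLad : ‖(gm : 𝔸) - ((u * g * u'⁻¹ : 𝔸ˣ) : 𝔸)‖ ≤ Θ * ((supDist p p' : ℝ) / (((ℓ + 1 : ℕ) : ℝ)) ^ levY i (chartY i p')) :=
          (norm_sub_conj_le_ladder' huu hgu huu').trans (hlad p p' hadm)
        have hladder : wEtaK (κ := κ) i s (⟨p, ν⟩, sl, a, c) (⟨p', ν⟩, sl, a, c) * (2 * ‖(gm : 𝔸) - ((u * g * u'⁻¹ : 𝔸ˣ) : 𝔸)‖ * ‖Yq‖) ≤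
            2 * Θ * L ^ 2 * basisBound39 b * ((geo9K i).len y' ^ (1 - s) * locS) := by
          calc _ ≤ wEtaK (κ := κ) i s (⟨p, ν⟩, sl, a, c) (⟨p', ν⟩, sl, a, c) *
                (2 * (Θ * ((supDist p p' : ℝ) / (((ℓ + 1 : ℕ) : ℝ)) ^ levY i (chartY i p'))) * (basisBound39 b * SupS)) := by
                refine mul_le_mul_of_nonneg_left ?_ hw0
                exact mul_le_mul (mul_le_mul_of_nonneg_left hLad (by norm_num)) hYqn (norm_nonneg _) (by positivity)
            _ = 2 * Θ * basisBound39 b * ((wEtaK (κ := κ) i s (⟨p, ν⟩, sl, a, c) (⟨p', ν⟩, sl, a, c) *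
                ((supDist p p' : ℝ) / (((ℓ + 1 : ℕ) : ℝ)) ^ levY i (chartY i p'))) * SupS) := by ring
            _ ≤ 2 * Θ * basisBound39 b * ((L ^ 2 * Wscl i s y') * SupS) :=
                mul_le_mul_of_nonneg_left (mul_le_mul_of_nonneg_right (hwlad (Or.inl h1) hadm) hSupS0) (by positivity)
            _ = 2 * Θ * L ^ 2 * basisBound39 b * (Wscl i s y' * SupS) := by ring
            _ ≤ 2 * Θ * L ^ 2 * basisBound39 b * ((geo9K i).len y' ^ (1 - s) * locS) := mul_le_mul_of_nonneg_left hlenSup (by positivity)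
        -- the source pair: each coordinate of `Yp − R(U(Γ_{p,p′})) Yq` is a source bond pair term
        have hP : ∀ a' : κ, NearPairK (κ := κ) i (⟨p, ν⟩, sl, a', c) (⟨p', ν⟩, sl, a', c) := fun a' => nearPairK_of_adm i hpp hadm
        have hcoord : ∀ a' : κ, wEtaK (κ := κ) i s (⟨p, ν⟩, sl, a, c) (⟨p', ν⟩, sl, a, c) * |b.repr (Yp - R gm Yq) a'| ≤ PairS := by
          intro a'
          have ht := ofPairsT_term_le (g := toB6 (geo9K i) R₀ H₀) (mem := fun (q : XBK κ i) (y : IBondY i) => NearY i y (srcY i q)) (P := NearPairK i) (w := wEtaK i s)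
            (hw := wEtaK_nonneg i s) (Δ := trDif b (taxiB i B cfg U₁)) (y := y') (z := ((⟨p, ν⟩ : FBondY i), sl, a', c)) (z' := ((⟨p', ν⟩ : FBondY i), sl, a', c))
            h1 (hP a') F
          rw [trDif_apply, hwa a'] at ht
          dsimp only at ht
          rw [hYp, hYq, hgm]
          exact ht
        have hD1 : wEtaK (κ := κ) i s (⟨p, ν⟩, sl, a, c) (⟨p', ν⟩, sl, a, c) * ‖Yp - R gm Yq‖ ≤ basisBound39 b * PairS := by
          by_cases hwz : wEtaK (κ := κ) i s (⟨p, ν⟩, sl, a, c) (⟨p', ν⟩, sl, a, c) = 0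
          · rw [hwz, zero_mul]; positivity
          have hwpos : 0 < wEtaK (κ := κ) i s (⟨p, ν⟩, sl, a, c) (⟨p', ν⟩, sl, a, c) := lt_of_le_of_ne hw0 (Ne.symm hwz)
          have hc' : ∀ a' : κ, |b.repr (Yp - R gm Yq) a'| ≤ PairS / wEtaK (κ := κ) i s (⟨p, ν⟩, sl, a, c) (⟨p', ν⟩, sl, a, c) := by
            intro a'; rw [le_div_iff₀ hwpos, mul_comm]; exact hcoord a'
          have hn := norm_le_basisBound39_of_repr_le b _ hc'
          calc _ ≤ wEtaK (κ := κ) i s (⟨p, ν⟩, sl, a, c) (⟨p', ν⟩, sl, a, c) *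
                (basisBound39 b * (PairS / wEtaK (κ := κ) i s (⟨p, ν⟩, sl, a, c) (⟨p', ν⟩, sl, a, c))) := mul_le_mul_of_nonneg_left hn hw0
            _ = basisBound39 b * PairS := by field_simp
        refine fin (Or.inl h1) ?_
        calc _ ≤ wEtaK (κ := κ) i s (⟨p, ν⟩, sl, a, c) (⟨p', ν⟩, sl, a, c) * (coordBound39 b * ‖Yp - R (u * g * u'⁻¹) Yq‖) :=
              mul_le_mul_of_nonneg_left hD hw0
          _ ≤ wEtaK (κ := κ) i s (⟨p, ν⟩, sl, a, c) (⟨p', ν⟩, sl, a, c) *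
              (coordBound39 b * (‖Yp - R gm Yq‖ + 2 * ‖(gm : 𝔸) - ((u * g * u'⁻¹ : 𝔸ˣ) : 𝔸)‖ * ‖Yq‖)) :=
              mul_le_mul_of_nonneg_left (mul_le_mul_of_nonneg_left hsplit hcb) hw0
          _ = coordBound39 b * (wEtaK (κ := κ) i s (⟨p, ν⟩, sl, a, c) (⟨p', ν⟩, sl, a, c) * ‖Yp - R gm Yq‖ +
              wEtaK (κ := κ) i s (⟨p, ν⟩, sl, a, c) (⟨p', ν⟩, sl, a, c) * (2 * ‖(gm : 𝔸) - ((u * g * u'⁻¹ : 𝔸ˣ) : 𝔸)‖ * ‖Yq‖)) := by ring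
          _ ≤ coordBound39 b * (basisBound39 b * PairS + 2 * Θ * L ^ 2 * basisBound39 b * ((geo9K i).len y' ^ (1 - s) * locS)) :=
              mul_le_mul_of_nonneg_left (add_le_add hD1 hladder) hcb
          _ ≤ coordBound39 b * (basisBound39 b * ((geo9K i).len y' ^ (1 - s) * locS) + 2 * Θ * L ^ 2 * basisBound39 b * ((geo9K i).len y' ^ (1 - s) * locS)) :=
              mul_le_mul_of_nonneg_left (add_le_add (mul_le_mul_of_nonneg_left hPairS_le hbb) le_rfl) hcb
          _ ≤ _ := by
              rw [hCi]
              have h0 : 0 ≤ (geo9K i).len y' ^ (1 - s) * locS := by have := Real.rpow_nonneg hy'.le (1 - s); positivity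
              have hcc : 0 ≤ coordBound39 b * basisBound39 b := mul_nonneg hcb hbb
              nlinarith [mul_nonneg hcc h0, mul_nonneg (mul_nonneg hcc h0) (pow_nonneg hL0.le 4)]
      · -- NOT admissible: the sup channel for both slices, weight `≤ L⁴·(Lʲ′η)^{−s}`
        have hwle := hwna (Or.inl h1) hadm
        have hDD : ‖Yp - R (u * g * u'⁻¹) Yq‖ ≤ 2 * (basisBound39 b * SupS) :=
          calc ‖Yp - R (u * g * u'⁻¹) Yq‖ ≤ ‖Yp‖ + ‖R (u * g * u'⁻¹) Yq‖ := norm_sub_le _ _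
            _ ≤ basisBound39 b * SupS + basisBound39 b * SupS := add_le_add hYpn ((norm_R_le hhu _).trans hYqn)
            _ = _ := by ring
        refine fin (Or.inl h1) ?_
        calc _ ≤ wEtaK (κ := κ) i s (⟨p, ν⟩, sl, a, c) (⟨p', ν⟩, sl, a, c) * (coordBound39 b * ‖Yp - R (u * g * u'⁻¹) Yq‖) :=
              mul_le_mul_of_nonneg_left hD hw0
          _ ≤ (L ^ 4 * Wscl i s y') * (coordBound39 b * (2 * (basisBound39 b * SupS))) :=
              mul_le_mul hwle (mul_le_mul_of_nonneg_left hDD hcb) (by positivity) (by positivity)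
          _ = 2 * coordBound39 b * basisBound39 b * L ^ 4 * (Wscl i s y' * SupS) := by ring
          _ ≤ 2 * coordBound39 b * basisBound39 b * L ^ 4 * ((geo9K i).len y' ^ (1 - s) * locS) := mul_le_mul_of_nonneg_left hlenSup (by positivity)
          _ ≤ _ := by
              rw [hCi]
              have h0 : 0 ≤ (geo9K i).len y' ^ (1 - s) * locS := by have := Real.rpow_nonneg hy'.le (1 - s); positivity
              have hcc : 0 ≤ coordBound39 b * basisBound39 b := mul_nonneg hcb hbb
              nlinarith [mul_nonneg hcc h0, mul_nonneg (mul_nonneg (mul_nonneg hcc h0) (pow_nonneg hL0.le 2)) hΘ]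
    · by_cases h2 : NearY i y' (chartY i p')
      · -- only the second bond source lies in Δ̃(y′): `Yp = 0`, `‖D‖ ≤ ‖Yq‖`
        have hYp0 : Yp = 0 := hX0 ⟨p, ν⟩ sl c h1
        have hDle : ‖Yp - R (u * g * u'⁻¹) Yq‖ ≤ ‖Yq‖ := by rw [hYp0, zero_sub, norm_neg]; exact norm_R_le hhu _
        by_cases hadm : Adm i ⟨p, ν⟩ ⟨p', ν⟩
        · -- the REVERSED bond pair is a source pair with first source in Δ̃(y′): every coordinate of `Yq`
          have hP' : ∀ a' : κ, NearPairK (κ := κ) i (⟨p', ν⟩, sl, a', c) (⟨p, ν⟩, sl, a', c) := fun a' => nearPairK_of_adm i hpp.symm (adm_symm i hadm)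
          have hcoord : ∀ a' : κ, wEtaK (κ := κ) i s (⟨p, ν⟩, sl, a, c) (⟨p', ν⟩, sl, a, c) * |F (⟨p', ν⟩, sl, a', c)| ≤ PairS := by
            intro a'
            have ht := ofPairsT_term_le (g := toB6 (geo9K i) R₀ H₀) (mem := fun (q : XBK κ i) (y : IBondY i) => NearY i y (srcY i q)) (P := NearPairK i) (w := wEtaK i s)
              (hw := wEtaK_nonneg i s) (Δ := trDif b (taxiB i B cfg U₁)) (y := y') (z := ((⟨p', ν⟩ : FBondY i), sl, a', c)) (z' := ((⟨p, ν⟩ : FBondY i), sl, a', c))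
              h2 (hP' a') F
            rw [trDif_apply, hwrev a'] at ht
            dsimp only at ht
            rw [show assembleK b sl c F ⟨p, ν⟩ = 0 from hYp0, hR0, sub_zero, repr_assembleK] at ht
            exact ht
          have hD2 : wEtaK (κ := κ) i s (⟨p, ν⟩, sl, a, c) (⟨p', ν⟩, sl, a, c) * ‖Yq‖ ≤ basisBound39 b * PairS := by
            by_cases hwz : wEtaK (κ := κ) i s (⟨p, ν⟩, sl, a, c) (⟨p', ν⟩, sl, a, c) = 0
            · rw [hwz, zero_mul]; positivity
            have hwpos : 0 < wEtaK (κ := κ) i s (⟨p, ν⟩, sl, a, c) (⟨p', ν⟩, sl, a, c) := lt_of_le_of_ne hw0 (Ne.symm hwz)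
            have hc' : ∀ a' : κ, |F (⟨p', ν⟩, sl, a', c)| ≤ PairS / wEtaK (κ := κ) i s (⟨p, ν⟩, sl, a, c) (⟨p', ν⟩, sl, a, c) := by
              intro a'; rw [le_div_iff₀ hwpos, mul_comm]; exact hcoord a'
            have hn : ‖Yq‖ ≤ basisBound39 b * (PairS / wEtaK (κ := κ) i s (⟨p, ν⟩, sl, a, c) (⟨p', ν⟩, sl, a, c)) := norm_assembleK_le b sl c F ⟨p', ν⟩ hc'
            calc _ ≤ wEtaK (κ := κ) i s (⟨p, ν⟩, sl, a, c) (⟨p', ν⟩, sl, a, c) *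
                  (basisBound39 b * (PairS / wEtaK (κ := κ) i s (⟨p, ν⟩, sl, a, c) (⟨p', ν⟩, sl, a, c))) := mul_le_mul_of_nonneg_left hn hw0
              _ = basisBound39 b * PairS := by field_simp
          refine fin (Or.inr h2) ?_
          calc _ ≤ wEtaK (κ := κ) i s (⟨p, ν⟩, sl, a, c) (⟨p', ν⟩, sl, a, c) * (coordBound39 b * ‖Yq‖) :=
                mul_le_mul_of_nonneg_left (hD.trans (mul_le_mul_of_nonneg_left hDle hcb)) hw0
            _ = coordBound39 b * (wEtaK (κ := κ) i s (⟨p, ν⟩, sl, a, c) (⟨p', ν⟩, sl, a, c) * ‖Yq‖) := by ring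
            _ ≤ coordBound39 b * (basisBound39 b * PairS) := mul_le_mul_of_nonneg_left hD2 hcb
            _ ≤ coordBound39 b * (basisBound39 b * ((geo9K i).len y' ^ (1 - s) * locS)) := mul_le_mul_of_nonneg_left (mul_le_mul_of_nonneg_left hPairS_le hbb) hcb
            _ ≤ _ := by
                rw [hCi]
                have h0 : 0 ≤ (geo9K i).len y' ^ (1 - s) * locS := by have := Real.rpow_nonneg hy'.le (1 - s); positivity
                have hcc : 0 ≤ coordBound39 b * basisBound39 b := mul_nonneg hcb hbb
                nlinarith [mul_nonneg hcc h0, mul_nonneg (mul_nonneg hcc h0) (pow_nonneg hL0.le 4),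
                  mul_nonneg (mul_nonneg (mul_nonneg hcc h0) (pow_nonneg hL0.le 2)) hΘ]
        · -- NOT admissible: the sup channel for `Yq`
          have hwle := hwna (Or.inr h2) hadm
          refine fin (Or.inr h2) ?_
          calc _ ≤ wEtaK (κ := κ) i s (⟨p, ν⟩, sl, a, c) (⟨p', ν⟩, sl, a, c) * (coordBound39 b * ‖Yq‖) :=
                mul_le_mul_of_nonneg_left (hD.trans (mul_le_mul_of_nonneg_left hDle hcb)) hw0
            _ ≤ (L ^ 4 * Wscl i s y') * (coordBound39 b * (basisBound39 b * SupS)) :=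
                mul_le_mul hwle (mul_le_mul_of_nonneg_left hYqn hcb) (by positivity) (by positivity)
            _ = coordBound39 b * basisBound39 b * L ^ 4 * (Wscl i s y' * SupS) := by ring
            _ ≤ coordBound39 b * basisBound39 b * L ^ 4 * ((geo9K i).len y' ^ (1 - s) * locS) := mul_le_mul_of_nonneg_left hlenSup (by positivity)
            _ ≤ _ := by
                rw [hCi]
                have h0 : 0 ≤ (geo9K i).len y' ^ (1 - s) * locS := by have := Real.rpow_nonneg hy'.le (1 - s); positivity
                have hcc : 0 ≤ coordBound39 b * basisBound39 b := mul_nonneg hcb hbb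
                nlinarith [mul_nonneg hcc h0, mul_nonneg (mul_nonneg hcc h0) (pow_nonneg hL0.le 4),
                  mul_nonneg (mul_nonneg (mul_nonneg hcc h0) (pow_nonneg hL0.le 2)) hΘ]
      · -- neither bond source lies in Δ̃(y′): the term vanishes
        have hYp0 : Yp = 0 := hX0 ⟨p, ν⟩ sl c h1
        have hYq0 : Yq = 0 := hX0 ⟨p', ν⟩ sl c h2
        rw [htr, hYp0, hYq0, hR0, sub_zero, hR0, neg_zero, map_zero, Finsupp.zero_apply, abs_zero, mul_zero]
        exact hM₂0
  have hpairPart : Wscl i (1 - s) y * (Size.ofPairsT (toB6 (geo9K i) R₀ H₀) (fun (q : XSK κ i) (y : IBondY i) => NearY i y q.1) (NearPair i) (wEta i s)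
        (wEta_nonneg i s) (trDif b (taxiS i B cfg U₁))).sz y (JTcoKH i b B cfg ν U₁ F) ≤ Cp * E * locS := by
    have h1 : (Size.ofPairsT (toB6 (geo9K i) R₀ H₀) (fun (q : XSK κ i) (y : IBondY i) => NearY i y q.1) (NearPair i) (wEta i s) (wEta_nonneg i s)
        (trDif b (taxiS i B cfg U₁))).sz y (JTcoKH i b B cfg ν U₁ F) ≤ M₂ :=
      ofPairsT_sz_le _ _ _ _ _ hM₂0 fun q q' (hq : NearY i y q.1) (hqq : NearPair i q q') => hpair q q' hq hqq
    calc Wscl i (1 - s) y * _ ≤ Wscl i (1 - s) y * M₂ := mul_le_mul_of_nonneg_left h1 (Wscl_nonneg i _ _)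
      _ = (Wscl i (1 - s) y * (geo9K i).len y ^ (1 - s)) * (Cp * E * locS) := by rw [hM₂]; ring
      _ = Cp * E * locS := by rw [← hW1inv, mul_inv_cancel₀ (ne_of_gt (lt_of_lt_of_le zero_lt_one (one_le_Wscl i (by linarith) y))), one_mul]
  -- assemble
  rw [mul_add]
  refine le_trans (add_le_add hsupPart hpairPart) (le_of_eq ?_)
  rw [hE, hCp, hCi, hrσ, hC₁]
  ring

end Main

end Literature.MathematicalPhysics.QuantumFieldTheory.Balaban1983to89.B9DivLetterTransportedInputClasses

end
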